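import Summits.Langlands.Langlands.Theorems.SqrtFiveQuarticCoversJInSqrtFiveModular
import Literature.NumberTheory.Automorphic.TotallyRealModularityProofs

/-!
# Route `SqrtFiveQuarticCovers`, crux `BoxBorelFive` (stmt-Langlands-17835), line `birth`:
# the registered stub `stub_smallJ` modulo its printed sources

The stub `stub_smallJ` of `Cruxes/BoxBorelFive/Lines/birth.lean` reads: for `K` a totally real
QUARTIC field (no hypothesis on `√5`) and `E / 𝓞 K` (`Δ ≠ 0`) whose `j`-invariant
`j = c₄(E_K)³ / Δ(E_K)` has `deg (minpoly_ℚ j) ≤ 2`, the curve is modular in the route's written-out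
(trace-only, Caraiani–Newton) sense.

`stub_smallJ_of_facts` proves exactly that registered signature (as the conclusion) from the
printed theorems it abbreviates, taken as the tree's named facts:
* `[ℚ(j) : ℚ] = 2`: `F = ℚ(j) ⊆ K` is a real quadratic field and `[K : F] = 2`, so `K/F` is Galois
  with cyclic group; the tree's `isModularEllipticCurve_of_jInvariant_eq_algebraMap_of_finrank_eq_two`
  (FLS 2015 Thm. 1 over `F` = `FLS2015_theorem1`, soluble base change = the named fact
  `isModularEllipticCurve_baseChange_of_isSolvable_of_isAutomorphicOfWeightZero` (Thorne 2016
  L7.1), twist invariance and CM PROVED in the tree) applies with `j₀ = j`;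
* `j ∈ ℚ` and `√5 ∈ K`: the same with `F = ℚ(√5)` (the tree's `jInSqrtFive_modular_of_facts`);
* `j ∈ ℚ` and `√5 ∉ K`: Box 2022 Thm. 1.1 (`Box2022_theorem1_1`) — every such curve is modular
  (used only here: a quartic `K` need not have a quadratic subfield to descend to).

HONEST STATUS: CONDITIONAL on three named facts (FLS 2015 Thm. 1, Thorne 2016 L7.1 / Langlands
base change, Box 2022 Thm. 1.1 — automorphy theorems with no carrier in the tree); it does not
close the stub by name and proves modularity of no new curve.  Helper of stmt-Langlands-17835.

References: [FreitasLeHungSiksek2015] Thm. 1, §7; [Thorne2016] Lemma 7.1; [Box2022] Thm. 1.1,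
§1.2 (p. 5).
-/

set_option linter.dupNamespace false -- project-wide option; `Summit.Langlands.Langlands` is the mandated namespace

noncomputable section

namespace Summit.Langlands.Langlands.Theorems.SqrtFiveQuarticCovers

open scoped NumberField IntermediateField Polynomial
open NumberField Polynomial Literature.NumberTheory.Automorphic

/-- **Registered stub `stub_smallJ` (line `birth`, stmt-Langlands-17835) modulo FLS 2015 Thm. 1,
soluble base change and Box 2022 Thm. 1.1.**  For `K` totally real quartic and `E / 𝓞 K`
(`Δ ≠ 0`) with `deg (minpoly_ℚ (c₄³/Δ)) ≤ 2`, the curve is modular in the route's written-out sense.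
Case split on `[ℚ(j) : ℚ] ∈ {1, 2}` and, for `j ∈ ℚ`, on `√5 ∈ K`; see the module docstring.
The conclusion is the registered stub signature verbatim.
[cite: FreitasLeHungSiksek2015, Thm. 1 and §7] [cite: Thorne2016, Lemma 7.1] [cite: Box2022, Thm. 1.1] -/
theorem stub_smallJ_of_facts (hFLS : FLS2015_theorem1)
    (hBC : Literature.NumberTheory.Automorphic.isModularEllipticCurve_baseChange_of_isSolvable_of_isAutomorphicOfWeightZero)
    (h11 : Box2022_theorem1_1) :
    ∀ (K : Type) [Field K] [NumberField K], NumberField.IsTotallyReal K → Module.finrank ℚ K = 4 → ∀ E : WeierstrassCurve (NumberField.RingOfIntegers K), E.Δ ≠ 0 → (minpoly ℚ ((E.baseChange K).c₄ ^ 3 / (E.baseChange K).Δ)).natDegree ≤ 2 → ((E.baseChange K).HasCM ∨ ∃ (hF : Literature.NumberTheory.Automorphic.isCompact_glFiniteIntegralLevel 2 K) (π : Literature.NumberTheory.Automorphic.CuspidalAutomorphicRepData 2 K hF), π.1.HasWeightZero ∧ ∀ᶠ w : IsDedekindDomain.HeightOneSpectrum (NumberField.RingOfIntegers K) in Filter.cofinite,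 ∃ α : Multiset ℂ, π.1.HasSatakeParamAt w α ∧ ((Real.sqrt w.residueCard : ℝ) : ℂ) * α.sum = (Literature.NumberTheory.Automorphic.frobTraceAt E w : ℂ)) := by
  intro K _ _ hK hd E hΔ hdeg
  haveI : IsTotallyReal K := hK
  set j : K := (E.baseChange K).c₄ ^ 3 / (E.baseChange K).Δ with hjdef
  have hj_int : IsIntegral ℚ j := Algebra.IsIntegral.isIntegral j
  have hFj : Module.finrank ℚ ℚ⟮j⟯ = (minpoly ℚ j).natDegree :=
    IntermediateField.adjoin.finrank hj_int
  have hpos : 0 < (minpoly ℚ j).natDegree := minpoly.natDegree_pos hj_int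
  -- the model read in `K`: `c₄(E_K) = c₄(E)`, `Δ(E_K) = Δ(E) ≠ 0`
  have hΔK : algebraMap (𝓞 K) K E.Δ ≠ 0 :=
    (map_ne_zero_iff _ (FaithfulSMul.algebraMap_injective (𝓞 K) K)).2 hΔ
  have hc : (E.baseChange K).c₄ = algebraMap (𝓞 K) K E.c₄ := by
    rw [WeierstrassCurve.baseChange, WeierstrassCurve.map_c₄]
  have hdd : (E.baseChange K).Δ = algebraMap (𝓞 K) K E.Δ := by
    rw [WeierstrassCurve.baseChange, WeierstrassCurve.map_Δ]
  by_cases h2 : (minpoly ℚ j).natDegree = 2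
  · -- `F = ℚ(j)` real quadratic, `[K : F] = 2`
    have hF2 : Module.finrank ℚ ℚ⟮j⟯ = 2 := hFj.trans h2
    haveI : IsTotallyReal ℚ⟮j⟯ := IsTotallyReal.of_algebra ℚ⟮j⟯ K
    have hFK : Module.finrank ℚ⟮j⟯ K = 2 := by
      have h := Module.finrank_mul_finrank ℚ ℚ⟮j⟯ K
      rw [hF2, hd] at h
      omega
    haveI : Algebra.IsQuadraticExtension ℚ⟮j⟯ K := ⟨hFK⟩
    haveI : IsGalois ℚ⟮j⟯ K := inferInstance
    haveI : IsSolvable (K ≃ₐ[ℚ⟮j⟯] K) :=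
      isSolvable_of_comm fun x y => (IsCyclic.commGroup (α := K ≃ₐ[ℚ⟮j⟯] K)).mul_comm x y
    set j₀ : ℚ⟮j⟯ := ⟨j, IntermediateField.mem_adjoin_simple_self ℚ j⟩ with hj₀
    have hj : (algebraMap (𝓞 K) K E.c₄) ^ 3 / algebraMap (𝓞 K) K E.Δ = algebraMap ℚ⟮j⟯ K j₀ := by
      rw [← hc, ← hdd]
      rfl
    exact isModularEllipticCurve_of_jInvariant_eq_algebraMap_of_finrank_eq_two hFLS hBC ℚ⟮j⟯ hF2 K
      E hΔ j₀ hj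
  · -- `j ∈ ℚ`
    have h1 : (minpoly ℚ j).natDegree = 1 := by omega
    have hbot : ℚ⟮j⟯ = ⊥ := IntermediateField.finrank_eq_one_iff.1 (hFj.trans h1)
    have hjmem : j ∈ (⊥ : IntermediateField ℚ K) :=
      hbot ▸ IntermediateField.mem_adjoin_simple_self ℚ j
    rw [IntermediateField.mem_bot] at hjmem
    obtain ⟨q, hq⟩ := hjmem
    by_cases h5 : IsSquare (5 : K)
    · -- `√5 ∈ K`: descend to `F = ℚ(√5)`
      obtain ⟨r, hr⟩ := h5
      have hr' : r ^ 2 = 5 := by rw [sq]; exact hr.symm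
      refine jInSqrtFive_modular_of_facts hFLS hBC K hK hd ⟨r, hr'⟩ E hΔ ⟨r, hr', q, 0, ?_⟩
      have hΔK' : (E.baseChange K).Δ ≠ 0 := by rw [hdd]; exact hΔK
      have hjq : j = (q : K) := by rw [← hq, eq_ratCast]
      rw [hjdef, div_eq_iff hΔK'] at hjq
      rw [Rat.cast_zero, zero_mul, add_zero]
      exact hjq
    · -- `√5 ∉ K`: Box 2022 Thm. 1.1
      exact Box2022_theorem1_1.isModularEllipticCurve h11 K hd h5 hΔ

end Summit.Langlands.Langlands.Theorems.SqrtFiveQuarticCovers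

end
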